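import Summits.Ventures.HSemireg.WedgeHankelRecurrenceGaussChristoffel

/-!
# Venture HSemireg — **THE GAUSS DEFECT**: if `Σ_{j ≤ t} μ_j v_j^p = Σ_l ν_l w_l^p` for `p ≤ 2t + 1` then for EVERY polynomial `F` of degree `≤ 2t + 2`
# `Σ_l ν_l F(w_l) − Σ_j μ_j F(v_j) = [X^{2t+2}]F · Σ_l ν_l q(w_l)²` with `q = ∏_j (X − v_j)`; hence with non-negative big weights the `(t+1)`-point rule UNDERESTIMATES every `F` with
# non-negative top coefficient, strictly for `s_{2t+2}` as soon as one big node of positive weight is not a small node — the Gauss rule is the LOWER principal representation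

HONEST FRAMING. Part of the Lean index of the computation cell `pub-hsemireg` (seat p10 gen 42, Sunday typer «UNIFORM-IN-n»).  Real polynomials and finite sums only (N262
`sum_mul_eval_eq_of_moments_eq`); no variety, no cohomology theory, no sheaf, no Ext group and no semiregularity map is constructed here; nothing here says that HC / HC_CM / HC_AV holds;
no Literature fact (unproved `Prop`) is declared or used.  Custodian versions as in `WedgeHankelSiegelIdeal` (1/3).
SOURCES (cited).  M. G. Krein, A. A. Nudel'man, *The Markov Moment Problem and Extremal Problems* (AMS Transl. Math. Monogr. 50, 1977), Ch. III §§1–2 (lower ∕ upper principal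
representations of a positive sequence `s_0, …, s_{2t+1}`: the lower one has `t + 1` nodes and gives `s_{2t+2}` its least admissible value); G. Szegő, *Orthogonal Polynomials*, AMS Colloq.
Publ. 23, §3.4 (Gauss–Jacobi quadrature; the Markov–Stieltjes form of the remainder, `∫ f dα − Σ λ_ν f(x_ν) = f^{(2n)}(ξ)/(2n)! · ∫ p_n² dα / k_n²`, of which this file is the exact
polynomial case); F. R. Gantmacher, *The Theory of Matrices* II, Ch. XV §16 (the representation `V_1` of Thm 18, typed N235).
PROOF TYPED HERE.  `F − [X^{2t+2}]F · q²` has degree `≤ 2t + 1`, so both sides integrate it identically; `q²` vanishes on the small nodes and is `q(w_l)²` on the big ones.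
DEDUP DISCLOSURE (`rg -n 'defect|underestimat|principal representation' Summits/Ventures/HSemireg/WedgeHankelRecurrence*`, 2026-09-02): N264 (`GaussNodesExtreme`) bounds the NODES by the
big nodes; nothing compares the next moment.  The 7 names below: 0 hits tree-wide.

WHAT IS IN THE TREE.  N262 `sum_mul_eval_eq_of_moments_eq`; Mathlib `Polynomial.natDegree_le_iff_coeff_eq_zero`, `Polynomial.Monic.coeff_natDegree`, `Polynomial.Monic.natDegree_pow`.
THIS FILE (namespace `Summit.Ventures.HSemireg.Wedge.HankelOuter` continued; CHAINED on N265; 0 definitions):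
* §1031 `monic_nodePoly_sq_and_natDegree` (`q²` monic of degree `2t + 2`), `natDegree_sub_C_mul_nodePoly_sq_le` (killing the top coefficient), **`sum_mul_eval_sub_eq_coeff_mul_defect`**
  (THE DEFECT IDENTITY), `sum_mul_eval_le_of_coeff_nonneg` (one-sided approximation for `[X^{2t+2}]F ≥ 0`, `ν ≥ 0`), `sum_mul_pow_le_of_moments_eq` (`Σ μ v^{2t+2} ≤ Σ ν w^{2t+2}`),
  `gauss_defect_pos` (`Σ_l ν_l q(w_l)² > 0` as soon as a big node of positive weight is not a small node), **`sum_mul_pow_lt_of_moments_eq`** (then STRICT).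
CAVEATS.  Discrete integrating representation only; nothing Ext-side.  New names only.
-/

open Module Polynomial
open scoped Matrix Polynomial

namespace Summit.Ventures.HSemireg.Wedge.HankelOuter

/-! ## §1031. The Gauss defect -/

/-- `q² = (∏_j (X − v_j))²` is monic of degree `2t + 2`. [bookkeeping; this file, §1031] -/
theorem monic_nodePoly_sq_and_natDegree {t : ℕ} (v : Fin (t + 1) → ℝ) :
    ((∏ j, (Polynomial.X - C (v j))) ^ 2).Monic ∧ ((∏ j, (Polynomial.X - C (v j))) ^ 2).natDegree = 2 * t + 2 := by
  have hqm : (∏ j, (Polynomial.X - C (v j))).Monic := monic_prod_of_monic _ _ fun j _ => monic_X_sub_C (v j)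
  have hqdeg : (∏ j, (Polynomial.X - C (v j))).natDegree = t + 1 := by
    rw [natDegree_prod_of_monic _ _ fun j _ => monic_X_sub_C (v j)]
    simp only [natDegree_X_sub_C, Finset.sum_const, Finset.card_univ, Fintype.card_fin, smul_eq_mul, mul_one]
  refine ⟨hqm.pow 2, ?_⟩
  rw [hqm.natDegree_pow, hqdeg]; ring

/-- Killing the top coefficient: `deg (F − [X^{2t+2}]F · q²) ≤ 2t + 1` for `deg F ≤ 2t + 2`. [bookkeeping; this file, §1031] -/
theorem natDegree_sub_C_mul_nodePoly_sq_le {t : ℕ} (v : Fin (t + 1) → ℝ) {F : ℝ[X]} (hF : F.natDegree ≤ 2 * t + 2) :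
    (F - C (F.coeff (2 * t + 2)) * (∏ j, (Polynomial.X - C (v j))) ^ 2).natDegree ≤ 2 * t + 1 := by
  obtain ⟨hm, hd⟩ := monic_nodePoly_sq_and_natDegree v
  rw [natDegree_le_iff_coeff_eq_zero]
  intro N hN
  rw [coeff_sub, coeff_C_mul]
  rcases (show N = 2 * t + 2 ∨ 2 * t + 2 < N by omega) with h | h
  · subst h
    have : ((∏ j, (Polynomial.X - C (v j))) ^ 2).coeff (2 * t + 2) = 1 := by rw [← hd]; exact hm.coeff_natDegree
    rw [this, mul_one, sub_self]
  · have h1 : F.coeff N = 0 := coeff_eq_zero_of_natDegree_lt (by omega)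
    have h2 : ((∏ j, (Polynomial.X - C (v j))) ^ 2).coeff N = 0 := coeff_eq_zero_of_natDegree_lt (by omega)
    rw [h1, h2, mul_zero, sub_self]

/-- **THE DEFECT IDENTITY**: if `Σ_j μ_j v_j^p = Σ_l ν_l w_l^p` for `p ≤ 2t + 1` (`t + 1` small nodes, arbitrary), then for every `F` with `deg F ≤ 2t + 2`
`Σ_l ν_l F(w_l) − Σ_j μ_j F(v_j) = [X^{2t+2}]F · Σ_l ν_l q(w_l)²`, `q = ∏_j (X − v_j)`. [Krein–Nudel'man III §1; Szegő §3.4 (Markov–Stieltjes remainder, polynomial case); this file, §1031] -/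
theorem sum_mul_eval_sub_eq_coeff_mul_defect {t N : ℕ} {μ v : Fin (t + 1) → ℝ} {ν w : Fin N → ℝ}
    (hmom : ∀ p, p ≤ 2 * t + 1 → ∑ j, μ j * v j ^ p = ∑ l, ν l * w l ^ p) {F : ℝ[X]} (hF : F.natDegree ≤ 2 * t + 2) :
    ∑ l, ν l * F.eval (w l) - ∑ j, μ j * F.eval (v j) = F.coeff (2 * t + 2) * ∑ l, ν l * ((∏ j, (Polynomial.X - C (v j))).eval (w l)) ^ 2 := by
  set q : ℝ[X] := ∏ j, (Polynomial.X - C (v j)) with hq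
  set c : ℝ := F.coeff (2 * t + 2) with hc
  have hG := sum_mul_eval_eq_of_moments_eq (N := 2 * t + 2) (fun p hp => hmom p (by omega)) (F := F - C c * q ^ 2)
    (lt_of_le_of_lt (natDegree_sub_C_mul_nodePoly_sq_le v hF) (by omega))
  simp only [eval_sub, eval_mul, eval_C, eval_pow, mul_sub, Finset.sum_sub_distrib] at hG
  have hq0 : ∀ j, q.eval (v j) = 0 := fun j => by
    rw [hq, eval_prod]; exact Finset.prod_eq_zero (Finset.mem_univ j) (by simp)
  have hsmall : ∑ j, μ j * (c * q.eval (v j) ^ 2) = 0 := Finset.sum_eq_zero fun j _ => by rw [hq0 j]; ring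
  rw [hsmall, sub_zero] at hG
  have hbig : ∑ l, ν l * (c * q.eval (w l) ^ 2) = c * ∑ l, ν l * q.eval (w l) ^ 2 := by
    rw [Finset.mul_sum]; exact Finset.sum_congr rfl fun l _ => by ring
  rw [hbig] at hG
  linarith

/-- **One-sided approximation**: with `ν_l ≥ 0`, the `(t+1)`-point rule underestimates every `F` of degree `≤ 2t + 2` with `[X^{2t+2}]F ≥ 0`. [Krein–Nudel'man III §2; this file, §1031] -/
theorem sum_mul_eval_le_of_coeff_nonneg {t N : ℕ} {μ v : Fin (t + 1) → ℝ} {ν w : Fin N → ℝ} (hν : ∀ l, 0 ≤ ν l)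
    (hmom : ∀ p, p ≤ 2 * t + 1 → ∑ j, μ j * v j ^ p = ∑ l, ν l * w l ^ p) {F : ℝ[X]} (hF : F.natDegree ≤ 2 * t + 2) (hc : 0 ≤ F.coeff (2 * t + 2)) :
    ∑ j, μ j * F.eval (v j) ≤ ∑ l, ν l * F.eval (w l) := by
  have h := sum_mul_eval_sub_eq_coeff_mul_defect hmom hF
  have hnn : 0 ≤ F.coeff (2 * t + 2) * ∑ l, ν l * ((∏ j, (Polynomial.X - C (v j))).eval (w l)) ^ 2 :=
    mul_nonneg hc (Finset.sum_nonneg fun l _ => mul_nonneg (hν l) (sq_nonneg _))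
  linarith

/-- `Σ_j μ_j v_j^{2t+2} ≤ Σ_l ν_l w_l^{2t+2}`: the Gauss rule gives the next even moment its least value among the non-negative representations of `s_0, …, s_{2t+1}`.
[Krein–Nudel'man III §2 (lower principal representation); this file, §1031] -/
theorem sum_mul_pow_le_of_moments_eq {t N : ℕ} {μ v : Fin (t + 1) → ℝ} {ν w : Fin N → ℝ} (hν : ∀ l, 0 ≤ ν l)
    (hmom : ∀ p, p ≤ 2 * t + 1 → ∑ j, μ j * v j ^ p = ∑ l, ν l * w l ^ p) :
    ∑ j, μ j * v j ^ (2 * t + 2) ≤ ∑ l, ν l * w l ^ (2 * t + 2) := by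
  have h := sum_mul_eval_le_of_coeff_nonneg hν hmom (F := Polynomial.X ^ (2 * t + 2)) (by rw [natDegree_X_pow]) (by rw [coeff_X_pow_self]; exact zero_le_one)
  simpa only [eval_pow, eval_X] using h

/-- **The defect is positive** as soon as one big node carrying positive weight is not a small node (all big weights non-negative). [Krein–Nudel'man III §2; this file, §1031] -/
theorem gauss_defect_pos {t N : ℕ} {v : Fin (t + 1) → ℝ} {ν w : Fin N → ℝ} (hν : ∀ l, 0 ≤ ν l) {l₀ : Fin N} (hl₀ : 0 < ν l₀) (hw : ∀ j, w l₀ ≠ v j) :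
    0 < ∑ l, ν l * ((∏ j, (Polynomial.X - C (v j))).eval (w l)) ^ 2 := by
  have hnn : ∀ l ∈ (Finset.univ : Finset (Fin N)), 0 ≤ ν l * ((∏ j, (Polynomial.X - C (v j))).eval (w l)) ^ 2 := fun l _ => mul_nonneg (hν l) (sq_nonneg _)
  refine lt_of_lt_of_le ?_ (Finset.single_le_sum hnn (Finset.mem_univ l₀))
  have hq : (∏ j, (Polynomial.X - C (v j))).eval (w l₀) ≠ 0 := by
    rw [eval_prod, Finset.prod_ne_zero_iff]
    intro j _
    rw [eval_sub, eval_X, eval_C]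
    exact sub_ne_zero.2 (hw j)
  positivity

/-- **STRICT UNDERESTIMATE OF `s_{2t+2}`**: if moreover some big node with positive weight is not a small node then `Σ_j μ_j v_j^{2t+2} < Σ_l ν_l w_l^{2t+2}` — two distinct non-negative
representations of `s_0, …, s_{2t+1}`, one of them `(t+1)`-atomic, differ at `s_{2t+2}`, the `(t+1)`-atomic one being the smaller. [Krein–Nudel'man III §2; this file, §1031] -/
theorem sum_mul_pow_lt_of_moments_eq {t N : ℕ} {μ v : Fin (t + 1) → ℝ} {ν w : Fin N → ℝ} (hν : ∀ l, 0 ≤ ν l) {l₀ : Fin N} (hl₀ : 0 < ν l₀) (hw : ∀ j, w l₀ ≠ v j)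
    (hmom : ∀ p, p ≤ 2 * t + 1 → ∑ j, μ j * v j ^ p = ∑ l, ν l * w l ^ p) :
    ∑ j, μ j * v j ^ (2 * t + 2) < ∑ l, ν l * w l ^ (2 * t + 2) := by
  have h := sum_mul_eval_sub_eq_coeff_mul_defect hmom (F := Polynomial.X ^ (2 * t + 2)) (by rw [natDegree_X_pow])
  rw [coeff_X_pow_self, one_mul] at h
  simp only [eval_pow, eval_X] at h
  have hd := gauss_defect_pos hν hl₀ hw (t := t)
  linarith

end Summit.Ventures.HSemireg.Wedge.HankelOuter
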